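import Summits.QuantumFields.YangMills.Theorems.FluctuationComparisonRegPrIntLOrganTangentSmallStepOneBond
import Summits.QuantumFields.YangMills.Theorems.FluctuationComparisonRegPrIntLRunPairOrganInnerWindowChains
import Summits.QuantumFields.YangMills.Theorems.CovariantDischargeUniformFluxLetters
import HarnessLib

/-!
# SMALL-STEP WINDOW PATHS FROM THE FLAT CONFIGURATION (LEAD-20520 w3 g24 WORD №4 (P-b)): ✓S4a BY NAME ∘ (P-a), DEFINITION-FREE

Cell `ym3-torus` (YM ladder rung R3 = continuum `SU(2)` Yang–Mills on the three-torus — a RUNG, NOT d = 4, NOT infinite volume, NOT a mass gap,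
NOT Clay).  Width seat `ym-ust-20520-w4` (gen 22); `--supports stmt-QuantumFields-20520 --as helper`, count-neutral, definition-free, default
heartbeats; no registry, binder or `Lines/` edit; the registered skeleton `Lines/semiclassical_s2beta.lean` v11.4 and its five stubs are untouched
(0∕5, ★★OWNER RULING №36).  v18-TEXT-INDEPENDENT.

WHAT.  ★★`exists_smallStep_windowPath`: in ✓S4a's regime (`∃ pW, ∀ p₀ ≥ pW, ∀ F γ b₀, 0 < γ ≤ 1, 0 < b₀, ∃ jW, ∀ j ≥ jW`) every configuration
`U` of the inner window `PlaqSmall (θBal F.L γ (√b₀) (p₀∕2) j)` is reached from the flat configuration `1` by a LIST of RIGHT EXPONENTIAL ONE-BOND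
MOVES `V ↦ update V q.1 (V q.1 · expPt q.2)` of size `‖q.2‖ ≤ δ` (any `δ > 0`), of length `≤ #PBond² · (⌈π∕δ⌉₊ + 2)`, ALL of whose prefix
configurations lie in `PlaqSmall (3 · θBal F.L γ b₀ p₀ j)`, and every PROBE-MOVED prefix `update V b (V b · expPt w)` in
`PlaqSmall (3·θBal + 4·dist1 (expPt w))` (the telescope's `hgood` asks both) — the path is written with an inline `List.foldl`, no definition.
:= ✓S4a `FluctuationComparisonRegPrIntL.RunPairOrgan.stub_innerWindowChains` (≡ ✓`FlatRatioTermination.innerWindowChains`: `≤ #PBond²` one-bond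
changes `W i → W (i+1)` inside the OUTER window `θBal(b₀,p₀)`) with each change subdivided by (P-a) ✓`…OrganTangentSmallStepOneBond.exists_subdivision_oneBondMove`
(both endpoints `θ`-small ⇒ every partial move `3θ`-small; `T³` supplies the second direction), and the one-parameter subgroup law
(✓`CovariantDischargeUniformFluxLetters.expPoint_add_smul`) to read `k` successive moves `(b, v)` as the partial move `expPt (k • v)`.
§3 (P-c) ★`exists_replicate_path_oneBond`: the junction-facing one-bond edition (two `θ`-window configurations one bond apart ⇒ a
`List.replicate k (b, v)` path between them, `‖v‖ ≤ δ`, prefixes `3θ`-small — LEAD WORD №6 (A) ∕ TN-ROOM).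
HONEST FLAGS (LEAD census): (1) the factor `3` is S4a's OUTER window tripled — to land in `θBal(b₀,p₀)` itself run S4a at `b₀∕3` (`θBal` is linear in
`b₀`); (2) S4a exports only the TOTAL count `≤ #PBond²`, so the per-bond multiplicity available BY NAME is the total length (volume-dependent); a
volume-uniform per-bond count needs the chord-sweep internals of ✓`…FlatRatioTerminationChordContraction` (not used here).

HONEST FRAMING: lattice bookkeeping over landed theorems; nothing of Bałaban's renormalisation-group analysis is asserted; TN-GR (v), O1∕O1ᵘ-H, the
crux `FluctuationComparisonRegPrIntL` (stmt-QuantumFields-20520) and `YM3TorusSU2` are NOT proved; no summit ∕ sub-problem statement is proved; rung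
R3 = SU(2) YM₃ on T³ — NOT d = 4, NOT infinite volume, NOT a mass gap, NOT Clay; the Yang–Mills mass gap is NOT proved by any of this.
[cite: Balaban1985Averaging, (8)-(9) p.19; Balaban1987RG1, (0.18) p.255]
-/

set_option autoImplicit false

noncomputable section

namespace Summit.QuantumFields.YangMills.Theorems.OrganTangentSmallStepWindowPath

open Function
open Literature.MathematicalPhysics.QuantumFieldTheory
open Literature.MathematicalPhysics.QuantumFieldTheory.Balaban1983to89
open Literature.MathematicalPhysics.QuantumFieldTheory.Balaban1983to89.T3ContinuumYM3Torus
open Literature.MathematicalPhysics.QuantumFieldTheory.Balaban1983to89.T3UnitScaleTilt (θBal)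
open T4CubeChartGnomonic (SU2)
open T4HaarSU2ExpChart (expPoint)
open T4CubeChartExp (toE expPt expPt_zero)
open Summit.QuantumFields.YangMills.Theorems.OrganTangentSmallStepOneBond (exists_subdivision_oneBondMove expPt_smul_ofLp)

/-! ## §1 The one-parameter subgroup in cube coordinates, and folding repeated moves -/

section Fold

variable {P : Params} {j : ℕ} [DecidableEq (PBond P j)]

/-- `expPt ((a + b) • v) = expPt (a • v) · expPt (b • v)` (the one-parameter subgroup law ✓`expPoint_add_smul` read in cube coordinates). [folklore] -/
theorem expPt_add_smul (a b : ℝ) (v : Fin 3 → ℝ) : expPt ((a + b) • v) = expPt (a • v) * expPt (b • v) := by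
  have h : ∀ c : ℝ, expPt (c • v) = expPoint (c • toE v) := fun c => by
    rw [show v = WithLp.ofLp (toE v) from rfl, expPt_smul_ofLp]
  rw [h, h, h]
  exact CovariantDischargeUniformFluxLetters.expPoint_add_smul a b (toE v)

/-- Folding `k` copies of the move `(b, v)` from `V` lands at the partial move `update V b (V b · expPt (k • v))`. [folklore] -/
theorem foldl_replicate_move (V : GaugeField P j SU2) (b : PBond P j) (v : Fin 3 → ℝ) (k : ℕ) :
    List.foldl (fun (W : GaugeField P j SU2) (q : PBond P j × (Fin 3 → ℝ)) => update W q.1 (W q.1 * expPt q.2)) V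
        (List.replicate k (b, v)) = update V b (V b * expPt ((k : ℝ) • v)) := by
  induction k with
  | zero => simp [expPt_zero]
  | succ k ih =>
    rw [List.replicate_succ', List.foldl_append, ih, List.foldl_cons, List.foldl_nil]
    simp only [update_self, update_idem]
    congr 1
    rw [Nat.cast_succ, expPt_add_smul, one_smul, mul_assoc]

end Fold

/-! ## §2 The path -/

section Path

/-- On `T³` every bond direction has a different companion direction. [folklore] -/
theorem exists_ne_dir (F : T3Family) (j : ℕ) (b : PBond (F.P j) 0) : ∃ ν : Fin (F.P j).d, ν ≠ b.dir := by
  by_cases h : b.dir = ⟨0, by simp⟩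
  · exact ⟨⟨1, by simp⟩, fun h' => by rw [h] at h'; exact absurd (congrArg Fin.val h') (by norm_num)⟩
  · exact ⟨⟨0, by simp⟩, fun h' => h h'.symm⟩

/-- ★★ **SMALL-STEP WINDOW PATHS** (see the module docstring): ✓S4a BY NAME ∘ (P-a). [cite: Balaban1985Averaging, (8)-(9) p.19; Balaban1987RG1, (0.18) p.255] -/
theorem exists_smallStep_windowPath :
    ∃ pW : ℝ, ∀ (p₀ : ℝ), pW ≤ p₀ → ∀ (F : T3Family) (γ b₀ : ℝ), 0 < γ → γ ≤ 1 → 0 < b₀ → ∃ jW : ℕ, ∀ j : ℕ, jW ≤ j →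
      ∀ U : GaugeField (F.P j) 0 ↥(Matrix.specialUnitaryGroup (Fin 2) ℂ), PlaqSmall (θBal F.L γ (Real.sqrt b₀) (p₀ / 2) j) U →
        ∀ δ : ℝ, 0 < δ → ∀ [DecidableEq (PBond (F.P j) 0)],
          ∃ path : List (PBond (F.P j) 0 × (Fin 3 → ℝ)),
            (∀ q ∈ path, ‖q.2‖ ≤ δ) ∧
            path.length ≤ Fintype.card (PBond (F.P j) 0) ^ 2 * (⌈Real.pi / δ⌉₊ + 2) ∧
            List.foldl (fun (W : GaugeField (F.P j) 0 ↥(Matrix.specialUnitaryGroup (Fin 2) ℂ)) (q : PBond (F.P j) 0 × (Fin 3 → ℝ)) =>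
                update W q.1 (W q.1 * expPt q.2)) 1 path = U ∧
            (∀ m : ℕ, m ≤ path.length → PlaqSmall (3 * θBal F.L γ b₀ p₀ j)
              (List.foldl (fun (W : GaugeField (F.P j) 0 ↥(Matrix.specialUnitaryGroup (Fin 2) ℂ)) (q : PBond (F.P j) 0 × (Fin 3 → ℝ)) =>
                update W q.1 (W q.1 * expPt q.2)) 1 (path.take m))) ∧
            ∀ m : ℕ, m ≤ path.length → ∀ (b : PBond (F.P j) 0) (w : Fin 3 → ℝ),
              PlaqSmall (3 * θBal F.L γ b₀ p₀ j + 4 * dist1 (expPt w))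
                (update (List.foldl (fun (W : GaugeField (F.P j) 0 ↥(Matrix.specialUnitaryGroup (Fin 2) ℂ)) (q : PBond (F.P j) 0 × (Fin 3 → ℝ)) =>
                  update W q.1 (W q.1 * expPt q.2)) 1 (path.take m)) b
                  ((List.foldl (fun (W : GaugeField (F.P j) 0 ↥(Matrix.specialUnitaryGroup (Fin 2) ℂ)) (q : PBond (F.P j) 0 × (Fin 3 → ℝ)) =>
                    update W q.1 (W q.1 * expPt q.2)) 1 (path.take m)) b * expPt w)) := by
  obtain ⟨pW, hS4a⟩ := FluctuationComparisonRegPrIntL.RunPairOrgan.stub_innerWindowChains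
  refine ⟨pW, fun p₀ hp₀ F γ b₀ hγ hγ1 hb₀ => ?_⟩
  obtain ⟨jW, hjW⟩ := hS4a p₀ hp₀ F γ b₀ hγ hγ1 hb₀
  refine ⟨jW, fun j hj U hU δ hδ _ => ?_⟩
  obtain ⟨n, W, hn, hW0, hWn, hWwin, hWstep⟩ := hjW j hj U hU
  set θ : ℝ := θBal F.L γ b₀ p₀ j with hθ
  set N : ℕ := ⌈Real.pi / δ⌉₊ + 2 with hN
  set mv : GaugeField (F.P j) 0 ↥(Matrix.specialUnitaryGroup (Fin 2) ℂ) → PBond (F.P j) 0 × (Fin 3 → ℝ) →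
      GaugeField (F.P j) 0 ↥(Matrix.specialUnitaryGroup (Fin 2) ℂ) := fun W q => update W q.1 (W q.1 * expPt q.2) with hmv
  -- the inductive construction: a path to `W i` for every `i ≤ n`
  have build : ∀ i : ℕ, i ≤ n → ∃ path : List (PBond (F.P j) 0 × (Fin 3 → ℝ)),
      (∀ q ∈ path, ‖q.2‖ ≤ δ) ∧ path.length ≤ i * N ∧ List.foldl mv 1 path = W i ∧
      ∀ m : ℕ, m ≤ path.length → PlaqSmall (3 * θ) (List.foldl mv 1 (path.take m)) := by
    intro i
    induction i with
    | zero =>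
      intro _
      refine ⟨[], by simp, by simp, ?_, ?_⟩
      · rw [List.foldl_nil]; funext e; exact (hW0 e).symm
      · intro m _
        rw [List.take_nil, List.foldl_nil]
        have hθ0 : 0 < θ := T3MinimiserStabilityReduction.θBal_pos F.hL.2.le hγ hγ1 hb₀ p₀ j
        have h1 : PlaqSmall θ (W 0) := hWwin 0 (Nat.zero_le _)
        have hW0' : W 0 = 1 := funext fun e => hW0 e
        rw [hW0'] at h1
        exact fun p => (h1 p).trans (by linarith)
    | succ i ih =>
      intro hi
      obtain ⟨path, hsz, hlen, hfold, hpre⟩ := ih (Nat.le_of_succ_le hi)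
      obtain ⟨b, hb⟩ := hWstep i (Nat.lt_of_succ_le hi)
      -- the one-bond change `W i → W (i+1)` as a right move by `g`
      set g : ↥(Matrix.specialUnitaryGroup (Fin 2) ℂ) := (W i b)⁻¹ * W (i + 1) b with hg
      have hupd : update (W i) b (W i b * g) = W (i + 1) := by
        funext e
        by_cases he : e = b
        · subst he; rw [update_self, hg, mul_inv_cancel_left]
        · rw [update_of_ne he]; exact hb e he
      have hWi : PlaqSmall θ (W i) := hWwin i (Nat.le_of_succ_le hi)
      have hWi1 : PlaqSmall θ (update (W i) b (W i b * g)) := by rw [hupd]; exact hWwin (i + 1) hi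
      obtain ⟨ν, hν⟩ := exists_ne_dir F j b
      obtain ⟨k, v, hk0, hkle, hv, hkg, -, hpart⟩ := exists_subdivision_oneBondMove (W i) b g hWi hWi1 ν hν hδ
      have hkN : k ≤ N := by
        have h1 : (k : ℝ) ≤ (⌈Real.pi / δ⌉₊ : ℝ) + 2 := hkle.trans (by linarith [Nat.le_ceil (Real.pi / δ)])
        rw [hN]; exact_mod_cast h1
      refine ⟨path ++ List.replicate k (b, v), ?_, ?_, ?_, ?_⟩
      · intro q hq
        rcases List.mem_append.1 hq with hq | hq
        · exact hsz q hq
        · rw [(List.eq_of_mem_replicate hq)]; exact hv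
      · rw [List.length_append, List.length_replicate, Nat.succ_mul]; exact add_le_add hlen hkN
      · rw [List.foldl_append, hfold, hmv, foldl_replicate_move, hkg, hupd]
      · intro m hm
        by_cases hml : m ≤ path.length
        · rw [List.take_append_of_le_length hml]
          exact hpre m hml
        · have hml' : path.length ≤ m := le_of_lt (not_le.1 hml)
          rw [List.take_append, List.take_of_length_le hml', List.foldl_append, hfold, List.take_replicate, hmv,
            foldl_replicate_move]
          exact hpart _ (min_le_right _ _)
  obtain ⟨path, hsz, hlen, hfold, hpre⟩ := build n le_rfl
  refine ⟨path, hsz, hlen.trans (Nat.mul_le_mul_right _ hn), ?_, hpre, ?_⟩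
  · rw [← hWn]; exact hfold
  · -- the probe-moved prefixes: one more bond deviation `≤ dist1 (expPt w)` (lit ✓`plaqSmall_of_bdev_le`)
    intro m hm b w
    exact T4ExpWindowSmallField.plaqSmall_of_bdev_le (hpre m hm) fun e =>
      OrganTangentSmallStepOneBond.dist1_bdev_update_le _ b (expPt w) e

/-- ★ **(P-c) THE JUNCTION-FACING ONE-BOND PATH** (LEAD-20520 w3 g24 WORD №6 (A) ∕ TN-ROOM): two `θ`-window configurations of `T³` one bond
apart, `U` and `update U b (U b · g)`, are joined by the path `List.replicate k (b, v)` of `k ≤ π∕δ + 2` right exponential moves of size `‖v‖ ≤ δ`,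
ALL of whose prefix configurations are `3θ`-small := ✓p797395 `exists_subdivision_oneBondMove` (second direction from `exists_ne_dir`) read through
`foldl_replicate_move`. [cite: Balaban1985Averaging, (8)-(9) p.19; Balaban1987RG1, (0.18) p.255] -/
theorem exists_replicate_path_oneBond (F : T3Family) (j : ℕ) [DecidableEq (PBond (F.P j) 0)] {θ δ : ℝ}
    (U : GaugeField (F.P j) 0 ↥(Matrix.specialUnitaryGroup (Fin 2) ℂ)) (b : PBond (F.P j) 0) (g : ↥(Matrix.specialUnitaryGroup (Fin 2) ℂ))
    (hU : PlaqSmall θ U) (hU' : PlaqSmall θ (update U b (U b * g))) (hδ : 0 < δ) :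
    ∃ (k : ℕ) (v : Fin 3 → ℝ), 0 < k ∧ (k : ℝ) ≤ Real.pi / δ + 2 ∧ ‖v‖ ≤ δ ∧
      List.foldl (fun (W : GaugeField (F.P j) 0 ↥(Matrix.specialUnitaryGroup (Fin 2) ℂ)) (q : PBond (F.P j) 0 × (Fin 3 → ℝ)) =>
          update W q.1 (W q.1 * expPt q.2)) U (List.replicate k (b, v)) = update U b (U b * g) ∧
      ∀ m : ℕ, m ≤ k → PlaqSmall (3 * θ)
        (List.foldl (fun (W : GaugeField (F.P j) 0 ↥(Matrix.specialUnitaryGroup (Fin 2) ℂ)) (q : PBond (F.P j) 0 × (Fin 3 → ℝ)) =>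
          update W q.1 (W q.1 * expPt q.2)) U ((List.replicate k (b, v)).take m)) := by
  obtain ⟨ν, hν⟩ := exists_ne_dir F j b
  obtain ⟨k, v, hk0, hkle, hv, hkg, -, hpart⟩ := exists_subdivision_oneBondMove U b g hU hU' ν hν hδ
  refine ⟨k, v, hk0, hkle, hv, ?_, fun m hm => ?_⟩
  · rw [foldl_replicate_move, hkg]
  · rw [List.take_replicate, foldl_replicate_move]
    exact hpart _ (min_le_right m k)

end Path

end Summit.QuantumFields.YangMills.Theorems.OrganTangentSmallStepWindowPath

end
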